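import Summits.MatrixMultiplication.MatrixMultiplication.Theses.FidelityWitnesses
import Summits.MatrixMultiplication.MatrixMultiplication.Theorems.FidelityWitnessesDiagonalPowerDecayStubProductFrame
import Literature.Computability.AlgebraicComplexity.AlderStrassen
import Literature.LinearAlgebra.Matrix.PosSemidefTrace

/-!
# Line `frame-negativity-singlet-fraction` for crux `FidelityWitnesses.DiagonalPowerDecay` (stmt-MatrixMultiplication-14053)

Planner's CHECKED skeleton (crux-plan r1, planner-cruxplan-stmt-MatrixMultiplication-14053-frame-negativity-sin-0,
2026-08-16) for idea card `Cruxes/DiagonalPowerDecay/Ideas/frame-negativity-singlet-fraction.md` (triage r1: pass ×3,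
merged with `realignment-negativity`). Every stub is stated over tree/Mathlib vocabulary ONLY (no local `def` in a
stub signature), so a landed stub is the registered signature verbatim; the local `def`s below are documentation and
are linked to the stub texts by the two kernel-checked identities `sum_redPT_flip` / `redPT_isHermitian`.

THE CRUX. `DiagonalPowerDecay : ∃ C δ, 0 < δ ∧ ∀ n S, tensorRank S ≤ n ^ 2 → ‖Σ S·⟨n,n,n⟩‖² ≤ C·n^{3−2δ}·Σ‖S‖²`
(`φ(n) := M(n,n²)/n³ ≤ C n^{−2δ}`). Slots: `S a b c`, `a = (κ,ν)` OUTPUT, `b = (κ,μ)`, `c = (μ',ν)`, all in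
`P n = Fin n × Fin n`; `matMulTensor ℂ n n n a b c = [a.1 = b.1 ∧ b.2 = c.1 ∧ a.2 = c.2]`.

THE LINE (card, in the notation fixed here). Decompose `S = Σ_{l<n²} w_l ⊗ u_l ⊗ v_l`; the products
`t_l = u_l ⊗ v_l` span `E ⊂ B ⊗ C = ℂ^{P n} ⊗ ℂ^{P n}` (`N := n²`-dimensional factors); take an orthonormal basis
`e` of `E`. ELIMINATE THE OUTPUT EXACTLY: `|⟨S,T⟩|² ≤ ‖S‖² · cap e`, `cap e = Σ_s Σ_{(κ,ν)} |Σ_m e_s (κ,m) (m,ν)|²`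
`= tr(P_E W_n)` (`W_n = Σ_a |T_a⟩⟨T_a| = 1_κ ⊗ |Ω̃⟩⟨Ω̃|_{μμ'} ⊗ 1_ν`, `Ω̃ = Σ_m |m⟩|m⟩`). SINGLET FRACTION: with the
REDUCED MIDDLE-PAIR OPERATOR `R_E := Tr_{κν} P_E` (PSD on `ℂ^n_μ ⊗ ℂ^n_{μ'}`, trace `dim E ≤ n²`) one has
`cap e = ⟨Ω̃|R_E|Ω̃⟩ = tr(R_E^Γ · FLIP)` (`Γ` = transpose on `μ'`; `sum_redPT_flip` below, kernel-checked, used by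
the glue), hence `cap e ≤ ‖R_E^Γ‖₁` (FLIP is a permutation = unitary; `flipTraceBound`/`cap_le_of_splitting` below,
kernel-checked, primal PSD-splitting form). So
`M(n,n²) ≤ ν_α(n) := sup_E ‖R_E^Γ‖₁ ≤ ν_β(n²) := sup_E ‖P_E^Γ‖₁ ≤ N^{3/2} = n³` (partial trace is trace-norm
contractive and commutes with `Γ`; the last is the card's proved ceiling / Cauchy–Schwarz `body_one_zero`), and the
line closes the crux from the MIDDLE-PAIR NEGATIVITY DECAY `ν_α(n) ≤ C n^{3−2δ}` (stub 2, OPEN, load-bearing) — the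
card's own object ("φ(n) is a singlet fraction of ρ_E = Tr_{i,k} P_E") and the LEAST exposed W-free statement of the
family: dual witnesses are crux = `{SWAP·(X⊗X*)}` (n² parameters) ⊂ stub 2 = `U(n²)` ⊂ card's `NegativityDecay` =
`U(n⁴)`; `NegativityDecay ⇒ stub 2 ⇒ crux`, both implications provable now (the second is this file's glue).

STUBS (k = 2 registered; the singlet lever and slice elimination are PROVED in this file; sizes are Lean sizes).
* PROVED in this file (no stub): `sliceElimination` — exact output elimination for general `n` (ported from the landed
  `n = 2` file `Theorems/FidelityWitnessesSevenEighthsLawStubSliceElimination.lean`; new: `slice_sum_matMulTensor` for all `n`).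
* `stub_productFrame` (provable now, M; stub 1) — Gram–Schmidt inside the product span; the RANK BOUND of the crux enters
  the line exactly here and in stub 2's hypothesis ("inside the span of `n²` products"; `Disproof.false_without_rank`).
* PROVED in this file (no stub): singlet fraction ≤ negativity — `flipTraceBound` (`Re Σ_x (Y − Z)(x,πx) ≤
  Re(tr Y + tr Z)` for PSD `Y, Z`, `π` = flip, via `(1 ∓ F)ᴴ(1 ∓ F) = 2(1 ∓ F)` and `Re tr(AB) ≥ 0` for PSD `A, B`),
  the singlet identity `sum_redPT_flip`, hence `cap_le_of_splitting` (`cap e ≤ tr Y + tr Z` for every PSD splitting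
  `R_E^Γ = Y − Z`, i.e. `cap e ≤ ‖R_E^Γ‖₁`) and `cap_le_trace_of_ppt`,
  the PPT LAW: a frame whose middle pair is PPT captures `≤ tr R_E = dim E ≤ n²`
  — the `δ = 1/2` law; it contains the card's `OrthogonalFrameLaw` (separable `R_E`) AND, numerically, every generic
  frame (kit j014152: random product frames have `R_E^Γ ≈ 1 ≻ 0`, `‖R_E^Γ‖₁ = n²` to machine precision, `n = 2, 3`).
  So ALL super-`n²` capture needs an NPT (entangled) middle pair, and `cap ≤ dim E + 2·𝒩(R_E)`.
* `stub_middlePairNegativityDecay` (OPEN, XL; the load-bearing stub, stub 2) — `‖R_E^Γ‖₁ ≤ C n^{3−2δ}` in PSD-splitting form,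
  for orthonormal bases `e` of spans of `n²` products. Brackets (kit j014152 + j014267, this seat, ascent values = lower
  bounds for the sups; j011037/j012660, cards/triage): `n = 2`: `M(2,4) = 3+√2 = 4.414 < sup ν_α ≈ 2+2√2 = 4.828`
  (coalesced-pair border frames, `cap = 4.00` there) `< ν_β(4) = 6.000 <` ceiling 8; `n = 3`: `M(3,9) ≥ 10.99`,
  `sup ν_α ≥ 12.00` (`cap = 9.97` there), `ν_β(9) ≥ 16.6`, ceiling 27 — local exponents `N = 4 → 9`: capture 1.125,
  `ν_α` 1.12, `ν_β` 1.26; `ν_α / M ≈ 1.09` at both sizes. Random frames: `ν_α = n²` EXACTLY (`R_E^Γ ≻ 0`), `ν_β ≈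
  1.2–1.35·n²`; the `ν_β`-maximisers (`‖P^Γ‖₁ = 6` at `N = 4`) have PPT middle pairs (`ν_α = 4.000`, capture `≈ 2.1`):
  the T-free level (β) is governed by frames irrelevant to the crux, the middle-pair level (α) tracks it. Needed:
  exponent of `ν_α` in `N = n²` below `3/2` (known `≥ 1/2 + 1/(ω−1) ≥ 1.229` from block fast matrix multiplication;
  `ν_α` is supermultiplicative under `⊗`, so `ν_α(2) ≥ 2+2√2` alone certifies exponent `≥ log_4(2+2√2) = 1.136`).
* `DiagonalPowerDecay_of` — the kernel-checked composition: `exists_eq_sum_triad_of_tensorRank_le` → product frame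
  (stub 1) → PSD splitting with small trace (stub 2) → `cap e ≤ C n^{3−2δ}` (`cap_le_of_splitting`, proved) → slices of
  `S` in `span e` (`slice_mem_span`) → slice elimination (`sliceElimination`, proved).

DISPROOF USED (`Cruxes/DiagonalPowerDecay/Disproof.lean`, cdisprove cycle 1, read 2026-08-16; no `Negative/` landing
exists yet, nothing to import): `false_without_rank` — the rank hypothesis is consumed as "`n²` products" (stub 1 →
hypothesis of stub 2; with `N²` products `E = B⊗C`, `R_E = n²·1`, `‖R^Γ‖₁ = n⁴`, and stub 2 is false, as it must be);
`body_one_zero` / `delta_le_half` / `delta_lt_three_sevenths` — no stub claims more than the crux allows: stub 2 is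
`∃ C δ`, its `δ` is capped by the same Kronecker families (block ⟨m,m,m⟩ frames have `‖R^Γ‖₁ ≥ cap ≥ p·m³ = n·m²`), and
the PPT law sits exactly at the tight endpoint `δ = 1/2`; `dpd_iff_unit_constant` / `not_dpd_iff` — stub 2 inherits
"one data point caps δ, none kills" (supermultiplicativity of `ν_α`); `omega_ge_of_body` — stub 2 ⇒ crux ⇒
`ω ≥ 6/(3−2δ)`, so stub 2 is at least as strong as `ω > 2` (unavoidable for any line through this crux, triage r1-3).
Negatives index (4 STPP/design refutations): unrelated. Dead lines: none recorded for this crux (`payload.dead_lines`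
absent; no `Lines/*.dead.md`).

NOT REGISTERED (documented for the lead; see the line card): the card's T-free `NegativityDecay` (β) — implies stub 2 by
`Tr_{κν}` (CPTP ⇒ trace-norm contraction, commutes with `Γ_{μ'}`), kept as the STRONGER ATTACK, not as the
obligation, because its maximisers are crux-irrelevant (above) and its empirical exponent `≈ 1.29` (j012660) leaves the
narrower window; the `ℓ₁(G⁻¹)` / `Σ_s‖α_s‖₁²` incoherence certificates (card § Transfer (iv), this seat's NOTES) —
valid upper bounds for `‖R_E^Γ‖₁` that are `O(N)` on incoherent frames and blow up at the border, i.e. one regime of a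
proof of stub 2, not a stub.
-/

noncomputable section

namespace Summit.MatrixMultiplication.MatrixMultiplication.Cruxes.DiagonalPowerDecay.FrameNegativitySingletFraction

open scoped BigOperators ComplexConjugate ComplexOrder Matrix
open Literature.Computability.AlgebraicComplexity
open Summit.MatrixMultiplication.MatrixMultiplication.Theses.FidelityWitnesses

set_option linter.unusedVariables false
set_option linter.dupNamespace false

/-! ## Vocabulary (workfile only; every stub below is stated with these UNFOLDED) -/

/-- A slot of `⟨n,n,n⟩`: index pairs (`a = (κ,ν)`, `b = (κ,μ)`, `c = (μ',ν)`). -/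
abbrev P (n : ℕ) : Type := Fin n × Fin n

/-- The product (rank-one) vector `x ⊗ y ∈ B ⊗ C = ℂ^{P n} ⊗ ℂ^{P n}`. -/
def prodVec {n : ℕ} (x y : P n → ℂ) : P n → P n → ℂ := fun b c => x b * y c

/-- `e` is an ORTHONORMAL `d`-FRAME of `B ⊗ C` for `⟨f, g⟩ = Σ conj f · g`. -/
def IsONFrame {n d : ℕ} (e : Fin d → P n → P n → ℂ) : Prop :=
  ∀ s t : Fin d, (∑ b, ∑ c, conj (e s b c) * e t b c) = if s = t then 1 else 0

/-- The frame lies inside the span of the `r` products `u_l ⊗ v_l`. -/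
def IsProductSpanned {n r d : ℕ} (u v : Fin r → P n → ℂ) (e : Fin d → P n → P n → ℂ) : Prop :=
  ∀ s, e s ∈ Submodule.span ℂ (Set.range fun l : Fin r => prodVec (u l) (v l))

/-- The CAPTURE of a frame: `cap e = Σ_s Σ_{a=(κ,ν)} |Σ_m e_s (κ,m) (m,ν)|²` (`= tr(P_E W_n) = ⟨Ω̃|Tr_{κν}P_E|Ω̃⟩`, the
unnormalised SINGLET FRACTION of the reduced middle-pair operator, for orthonormal `e` spanning `E`). -/
def cap {n d : ℕ} (e : Fin d → P n → P n → ℂ) : ℝ :=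
  ∑ s, ∑ a : P n, ‖∑ m : Fin n, e s (a.1, m) (m, a.2)‖ ^ 2

/-- The REDUCED MIDDLE-PAIR OPERATOR, PARTIALLY TRANSPOSED: with `b = (κ,μ)`, `c = (μ',ν)`,
`redPT e = (Tr_{κν} Σ_s |e_s⟩⟨e_s|)^{Γ_{μ'}}`, an operator on `ℂ^n_μ ⊗ ℂ^n_{μ'}`; rows `x = (μ,μ')`, columns
`y = (λ,λ')`: `R^Γ(x,y) = R((μ,λ'),(λ,μ')) = Σ_s Σ_{κ,ν} e_s (κ,μ) (λ',ν) · conj (e_s (κ,λ) (μ',ν))`. -/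
def redPT {n d : ℕ} (e : Fin d → P n → P n → ℂ) : Matrix (P n) (P n) ℂ :=
  Matrix.of fun x y : P n => ∑ s, ∑ κ : Fin n, ∑ ν : Fin n, e s (κ, x.1) (y.2, ν) * conj (e s (κ, y.1) (x.2, ν))

/-! ## Two kernel-checked identities fixing the conventions (`sum_redPT_flip` is used by the glue) -/

/-- `redPT e` is Hermitian (so a PSD splitting `Y − Z` as in stubs 3–4 exists, by the spectral theorem, and the least
`tr Y + tr Z` is the trace norm `‖R_E^Γ‖₁`). -/
theorem redPT_isHermitian {n d : ℕ} (e : Fin d → P n → P n → ℂ) : (redPT e).IsHermitian := by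
  ext x y
  simp only [redPT, Matrix.conjTranspose_apply, Matrix.of_apply, star_sum, star_mul', RCLike.star_def,
    RingHomCompTriple.comp_apply, RingHom.id_apply]
  refine Finset.sum_congr rfl fun s _ => Finset.sum_congr rfl fun κ _ => Finset.sum_congr rfl fun ν _ => ?_
  ring

/-- **The singlet identity**: `Σ_x (redPT e) x (x.2, x.1) = cap e` — the capture is the trace of the reduced partial
transpose against the FLIP `|μ μ'⟩ ↦ |μ' μ⟩` (equivalently `cap e = ⟨Ω̃| Tr_{κν} P_E |Ω̃⟩`). This is the whole
"singlet fraction" dictionary of the card, for every `n` and every family `e` (orthonormality not needed here). -/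
theorem sum_redPT_flip {n d : ℕ} (e : Fin d → P n → P n → ℂ) :
    (∑ x : P n, (redPT e) x (x.2, x.1)) = ((cap e : ℝ) : ℂ) := by
  have hsq : ∀ z : ℂ, ((‖z‖ : ℝ) : ℂ) ^ 2 = z * conj z := fun z => by
    rw [Complex.mul_conj, Complex.normSq_eq_norm_sq]; norm_cast
  calc (∑ x : P n, (redPT e) x (x.2, x.1))
      = ∑ x : P n, ∑ s, ∑ a : P n, e s (a.1, x.1) (x.1, a.2) * conj (e s (a.1, x.2) (x.2, a.2)) := by
        refine Finset.sum_congr rfl fun x _ => ?_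
        simp only [redPT, Matrix.of_apply]
        refine Finset.sum_congr rfl fun s _ => ?_
        exact (Fintype.sum_prod_type' _).symm
    _ = ∑ s, ∑ a : P n, ∑ x : P n, e s (a.1, x.1) (x.1, a.2) * conj (e s (a.1, x.2) (x.2, a.2)) := by
        rw [Finset.sum_comm]
        refine Finset.sum_congr rfl fun s _ => ?_
        rw [Finset.sum_comm]
    _ = ∑ s, ∑ a : P n, (∑ m : Fin n, e s (a.1, m) (m, a.2)) * conj (∑ m : Fin n, e s (a.1, m) (m, a.2)) := by
        refine Finset.sum_congr rfl fun s _ => Finset.sum_congr rfl fun a _ => ?_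
        rw [map_sum, Finset.sum_mul_sum]
        exact Fintype.sum_prod_type' fun m m' : Fin n => e s (a.1, m) (m, a.2) * conj (e s (a.1, m') (m', a.2))
    _ = ((cap e : ℝ) : ℂ) := by
        simp only [cap, Complex.ofReal_sum, Complex.ofReal_pow, hsq]

/-! ### Singlet fraction ≤ negativity, kernel-checked: the flip–trace bound
(planned as `stub_flipTraceBound`, PROVED here instead; with `sum_redPT_flip` it gives `cap e ≤ tr Y + tr Z` for every PSD
splitting `R_E^Γ = Y − Z`, i.e. `cap e ≤ ‖R_E^Γ‖₁`, and the PPT LAW `cap e ≤ tr R_E = dim E` when `R_E^Γ ⪰ 0`.) -/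

/-- The FLIP `(μ,μ') ↦ (μ',μ)` as a permutation matrix: `flipM n x y = [y = (x.2, x.1)]`. -/
def flipM (n : ℕ) : Matrix (P n) (P n) ℂ :=
  Matrix.of fun x y => if y = (x.2, x.1) then 1 else 0

theorem flipM_apply {n : ℕ} (x y : P n) : flipM n x y = if y = (x.2, x.1) then 1 else 0 := rfl

/-- Trace against the flip reads off the flipped diagonal. -/
theorem trace_mul_flipM {n : ℕ} (M : Matrix (P n) (P n) ℂ) :
    (M * flipM n).trace = ∑ x, M x (x.2, x.1) := by
  unfold Matrix.trace
  refine Finset.sum_congr rfl fun x _ => ?_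
  rw [Matrix.diag_apply, Matrix.mul_apply, Finset.sum_eq_single (x.2, x.1)]
  · simp [flipM_apply]
  · intro y _ hy
    rw [flipM_apply, if_neg, mul_zero]
    intro h
    apply hy
    rw [h]
  · intro h; exact absurd (Finset.mem_univ _) h

/-- The flip is an involution … -/
theorem flipM_mul_flipM {n : ℕ} : flipM n * flipM n = 1 := by
  ext x z
  rw [Matrix.mul_apply, Finset.sum_eq_single (x.2, x.1)]
  · rw [flipM_apply, flipM_apply, if_pos rfl, one_mul, Matrix.one_apply]
    by_cases h : x = z
    · subst h; simp
    · rw [if_neg, if_neg h]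
      intro hz; apply h; rw [hz]
  · intro y _ hy
    rw [flipM_apply, if_neg (Ne.symm (fun h => hy h.symm)), zero_mul]
  · intro h; exact absurd (Finset.mem_univ _) h

/-- … and Hermitian (a real symmetric permutation matrix). -/
theorem flipM_conjTranspose {n : ℕ} : (flipM n)ᴴ = flipM n := by
  ext x y
  rw [Matrix.conjTranspose_apply, flipM_apply, flipM_apply]
  by_cases h : y = (x.2, x.1)
  · have h' : x = (y.2, y.1) := by rw [h]
    rw [if_pos h, if_pos h', star_one]
  · have h' : ¬ x = (y.2, y.1) := fun h' => h (by rw [h'])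
    rw [if_neg h, if_neg h', star_zero]

/-- **The flip–trace bound** (singlet fraction ≤ negativity, as a pure matrix fact): for PSD `Y, Z` on
`ℂ^n_μ ⊗ ℂ^n_{μ'}`, `Re Σ_x (Y − Z)(x, flip x) ≤ Re (tr Y + tr Z)`. Proof: `(1 ∓ F)ᴴ(1 ∓ F) = 2(1 ∓ F)` for the flip
matrix `F` (`F² = 1`, `Fᴴ = F`), and `Re tr(A B) ≥ 0` for PSD `A, B`
(`Literature.LinearAlgebra.Matrix.re_trace_mul_nonneg_of_posSemidef`), so `Re tr(Y F) ≤ Re tr Y` and `−Re tr(Z F) ≤ Re tr Z`. -/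
theorem flipTraceBound {n : ℕ} (Y Z : Matrix (Fin n × Fin n) (Fin n × Fin n) ℂ)
    (hY : Y.PosSemidef) (hZ : Z.PosSemidef) :
    (∑ x : Fin n × Fin n, (Y - Z) x (x.2, x.1)).re ≤ (Y.trace + Z.trace).re := by
  set F := flipM n with hFdef
  have hFF : F * F = 1 := flipM_mul_flipM
  have hFH : Fᴴ = F := flipM_conjTranspose
  have hsq1 : (1 - F)ᴴ * (1 - F) = 1 - F - F + 1 := by
    rw [Matrix.conjTranspose_sub, Matrix.conjTranspose_one, hFH, sub_mul, one_mul, mul_sub, mul_one, hFF]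
    abel
  have hsq2 : (1 + F)ᴴ * (1 + F) = 1 + F + F + 1 := by
    rw [Matrix.conjTranspose_add, Matrix.conjTranspose_one, hFH, add_mul, one_mul, mul_add, mul_one, hFF]
    abel
  have e1 := Literature.LinearAlgebra.Matrix.re_trace_mul_nonneg_of_posSemidef hY
    (Matrix.posSemidef_conjTranspose_mul_self (1 - F))
  have e2 := Literature.LinearAlgebra.Matrix.re_trace_mul_nonneg_of_posSemidef hZ
    (Matrix.posSemidef_conjTranspose_mul_self (1 + F))
  rw [hsq1, Matrix.mul_add, Matrix.mul_sub, Matrix.mul_sub, Matrix.mul_one, Matrix.trace_add,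
    Matrix.trace_sub, Matrix.trace_sub] at e1
  rw [hsq2, Matrix.mul_add, Matrix.mul_add, Matrix.mul_add, Matrix.mul_one, Matrix.trace_add,
    Matrix.trace_add, Matrix.trace_add] at e2
  simp only [Complex.add_re, Complex.sub_re] at e1 e2
  rw [← trace_mul_flipM, Matrix.sub_mul, Matrix.trace_sub, Complex.sub_re, Complex.add_re]
  linarith

/-- **Singlet fraction ≤ negativity** for frames: `cap e ≤ Re(tr Y + tr Z)` for every PSD splitting `redPT e = Y − Z`
(so `cap e ≤ ‖R_E^Γ‖₁`), from `sum_redPT_flip` and `flipTraceBound`. -/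
theorem cap_le_of_splitting {n d : ℕ} (e : Fin d → P n → P n → ℂ) {Y Z : Matrix (P n) (P n) ℂ}
    (hY : Y.PosSemidef) (hZ : Z.PosSemidef) (hsplit : redPT e = Y - Z) :
    cap e ≤ (Y.trace + Z.trace).re := by
  have hre : cap e = (∑ x : P n, (Y - Z) x (x.2, x.1)).re := by
    rw [← hsplit, sum_redPT_flip, Complex.ofReal_re]
  rw [hre]
  exact flipTraceBound Y Z hY hZ

/-- **The PPT law**: a frame whose partially transposed middle-pair reduction is PSD (PPT middle pair) captures at most
`Re tr(redPT e)` (`= dim E` for an orthonormal frame) — the `δ = 1/2` law; it contains the card's `OrthogonalFrameLaw`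
(separable `R_E`) and, numerically, every generic product frame (kit j014152). -/
theorem cap_le_trace_of_ppt {n d : ℕ} (e : Fin d → P n → P n → ℂ) (hppt : (redPT e).PosSemidef) :
    cap e ≤ (redPT e).trace.re := by
  have h := cap_le_of_splitting e hppt Matrix.PosSemidef.zero (by rw [sub_zero])
  simpa using h

/-! ### Slice elimination (exact output elimination), kernel-checked for general `n`
(planned as `stub_sliceElimination`; PROVED here by porting the landed `n = 2` file
`Theorems/FidelityWitnessesSevenEighthsLawStubSliceElimination.lean` — only `slice_sum_matMulTensor` needed a new proof.)

#### Finite Cauchy–Schwarz for complex sums -/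

/-- Cauchy–Schwarz for a finite complex sum: `|Σ f g|² ≤ (Σ |f|²) (Σ |g|²)`. -/
theorem norm_sum_mul_sq_le {ι : Type*} (s : Finset ι) (f g : ι → ℂ) :
    ‖∑ i ∈ s, f i * g i‖ ^ 2 ≤ (∑ i ∈ s, ‖f i‖ ^ 2) * ∑ i ∈ s, ‖g i‖ ^ 2 := by
  have h1 : ‖∑ i ∈ s, f i * g i‖ ≤ ∑ i ∈ s, ‖f i‖ * ‖g i‖ := by
    calc ‖∑ i ∈ s, f i * g i‖ ≤ ∑ i ∈ s, ‖f i * g i‖ := norm_sum_le _ _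
      _ = ∑ i ∈ s, ‖f i‖ * ‖g i‖ := by simp_rw [norm_mul]
  calc ‖∑ i ∈ s, f i * g i‖ ^ 2 ≤ (∑ i ∈ s, ‖f i‖ * ‖g i‖) ^ 2 :=
        pow_le_pow_left₀ (norm_nonneg _) h1 2
    _ ≤ (∑ i ∈ s, ‖f i‖ ^ 2) * ∑ i ∈ s, ‖g i‖ ^ 2 := Finset.sum_mul_sq_le_sq_mul_sq s _ _

/-- Cauchy–Schwarz for a finite complex double sum: `|Σ_{a,s} f g|² ≤ (Σ_{a,s} |f|²) (Σ_{a,s} |g|²)`. -/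
theorem norm_sum_sum_mul_sq_le {α β : Type*} [Fintype α] [Fintype β] (f g : α → β → ℂ) :
    ‖∑ a, ∑ s, f a s * g a s‖ ^ 2 ≤ (∑ a, ∑ s, ‖f a s‖ ^ 2) * ∑ a, ∑ s, ‖g a s‖ ^ 2 := by
  have h := norm_sum_mul_sq_le Finset.univ (fun p : α × β => f p.1 p.2) (fun p => g p.1 p.2)
  simpa only [Fintype.sum_prod_type] using h

/-! #### The output slices of `⟨n,n,n⟩` -/

/-- The output slice `T_a` of `⟨n,n,n⟩` is the indicator of `(b,c) = ((a.1,m),(m,a.2))`, `m : Fin n`: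
pairing any `F` against it reads off `Σ_m F (a.1,m) (m,a.2)`. -/
theorem slice_sum_matMulTensor {n : ℕ} (F : (Fin n × Fin n) → (Fin n × Fin n) → ℂ) (a : Fin n × Fin n) :
    ∑ b, ∑ c, F b c * matMulTensor ℂ n n n a b c = ∑ m : Fin n, F (a.1, m) (m, a.2) := by
  have inner : ∀ b : Fin n × Fin n,
      (∑ c, F b c * matMulTensor ℂ n n n a b c) = if a.1 = b.1 then F b (b.2, a.2) else 0 := by
    intro b
    by_cases hb : a.1 = b.1
    · rw [if_pos hb, Finset.sum_eq_single (b.2, a.2)]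
      · simp [matMulTensor, hb]
      · intro c _ hc
        simp only [matMulTensor]
        rw [if_neg, mul_zero]
        rintro ⟨-, h2, h3⟩
        exact hc (Prod.ext h2.symm h3.symm)
      · intro h; exact absurd (Finset.mem_univ _) h
    · rw [if_neg hb]
      refine Finset.sum_eq_zero fun c _ => ?_
      simp only [matMulTensor]
      rw [if_neg (fun h => hb h.1), mul_zero]
  simp_rw [inner]
  rw [Fintype.sum_prod_type, Finset.sum_comm]
  refine Finset.sum_congr rfl fun m _ => ?_
  rw [Finset.sum_ite_eq]
  simp

/-! #### Orthonormal expansion of the slices -/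

/-- Moving a sum over the frame index out of a double slot sum. -/
theorem slot_sum_comm_frame {n k : ℕ} (Z : (Fin n × Fin n) → (Fin n × Fin n) → Fin k → ℂ) :
    ∑ b, ∑ c, ∑ s, Z b c s = ∑ s, ∑ b, ∑ c, Z b c s := by
  calc ∑ b, ∑ c, ∑ s, Z b c s = ∑ b, ∑ s, ∑ c, Z b c s :=
        Finset.sum_congr rfl fun b _ => Finset.sum_comm
    _ = ∑ s, ∑ b, ∑ c, Z b c s := Finset.sum_comm

/-- Coefficient identification: if `F = Σ_s d_s e_s` for an orthonormal frame `e`, then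
`⟨e_t, F⟩ = d_t`. -/
theorem inner_frame_slice {n k : ℕ} (e : Fin k → (Fin n × Fin n) → (Fin n × Fin n) → ℂ)
    (he : ∀ s t : Fin k, (∑ b, ∑ c, conj (e s b c) * e t b c) = if s = t then 1 else 0)
    (d : Fin k → ℂ) (F : (Fin n × Fin n) → (Fin n × Fin n) → ℂ)
    (hF : ∀ b c, F b c = ∑ s, d s * e s b c) (t : Fin k) :
    ∑ b, ∑ c, conj (e t b c) * F b c = d t := by
  calc ∑ b, ∑ c, conj (e t b c) * F b c
      = ∑ b, ∑ c, ∑ s, d s * (conj (e t b c) * e s b c) := by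
        refine Finset.sum_congr rfl fun b _ => Finset.sum_congr rfl fun c _ => ?_
        rw [hF b c, Finset.mul_sum]
        exact Finset.sum_congr rfl fun s _ => by ring
    _ = ∑ s, d s * ∑ b, ∑ c, conj (e t b c) * e s b c := by
        rw [slot_sum_comm_frame]
        refine Finset.sum_congr rfl fun s _ => ?_
        rw [Finset.mul_sum]
        exact Finset.sum_congr rfl fun b _ => by rw [Finset.mul_sum]
    _ = ∑ s, d s * (if t = s then 1 else 0) := by
        refine Finset.sum_congr rfl fun s _ => ?_
        rw [he t s]
    _ = d t := by simp

/-- Parseval inside the span of an orthonormal frame: if `F = Σ_s d_s e_s` then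
`Σ_{b,c} |F b c|² = Σ_s |d_s|²`. -/
theorem parseval_slice {n k : ℕ} (e : Fin k → (Fin n × Fin n) → (Fin n × Fin n) → ℂ)
    (he : ∀ s t : Fin k, (∑ b, ∑ c, conj (e s b c) * e t b c) = if s = t then 1 else 0)
    (d : Fin k → ℂ) (F : (Fin n × Fin n) → (Fin n × Fin n) → ℂ)
    (hF : ∀ b c, F b c = ∑ s, d s * e s b c) :
    ∑ b, ∑ c, ‖F b c‖ ^ 2 = ∑ s, ‖d s‖ ^ 2 := by
  have hFc : ∀ b c, conj (F b c) = ∑ s, conj (d s) * conj (e s b c) := by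
    intro b c
    rw [hF b c, map_sum]
    exact Finset.sum_congr rfl fun s _ => by rw [map_mul]
  have hC : (∑ b, ∑ c, conj (F b c) * F b c) = ∑ s, conj (d s) * d s := by
    calc ∑ b, ∑ c, conj (F b c) * F b c
        = ∑ b, ∑ c, ∑ s, conj (d s) * (conj (e s b c) * F b c) := by
          refine Finset.sum_congr rfl fun b _ => Finset.sum_congr rfl fun c _ => ?_
          rw [hFc b c, Finset.sum_mul]
          exact Finset.sum_congr rfl fun s _ => by ring
      _ = ∑ s, conj (d s) * ∑ b, ∑ c, conj (e s b c) * F b c := by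
          rw [slot_sum_comm_frame]
          refine Finset.sum_congr rfl fun s _ => ?_
          rw [Finset.mul_sum]
          exact Finset.sum_congr rfl fun b _ => by rw [Finset.mul_sum]
      _ = ∑ s, conj (d s) * d s :=
          Finset.sum_congr rfl fun s _ => by rw [inner_frame_slice e he d F hF s]
  simp_rw [Complex.conj_mul'] at hC
  exact_mod_cast hC

/-! #### Slice elimination -/

/-- **Slice elimination (exact output elimination), general `n`.** For an orthonormal `k`-frame `e` of
`ℂ^{P n} ⊗ ℂ^{P n}` (for `⟨f,g⟩ = Σ conj f · g`) and a tensor `S` all of whose output slices `S(a,·,·)` lie in `span e`: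
`|Σ_{a,b,c} S(a,b,c) ⟨n,n,n⟩(a,b,c)|² ≤ (Σ |S|²) · Σ_s Σ_a |Σ_m e_s (a.1,m) (m,a.2)|²` (`= ‖S‖² · cap e`).
Proof: expand `S(a,·,·) = Σ_s d_{a,s} e_s`; the slice pairing is `Σ_s d_{a,s} τ_{s,a}` (`slice_sum_matMulTensor`),
`Σ_{b,c}|S(a,b,c)|² = Σ_s |d_{a,s}|²` (`parseval_slice`), and Cauchy–Schwarz over `(a,s)` (`norm_sum_sum_mul_sq_le`). -/
theorem sliceElimination {n k : ℕ} (e : Fin k → (Fin n × Fin n) → (Fin n × Fin n) → ℂ)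
    (he : ∀ s t : Fin k, (∑ b, ∑ c, conj (e s b c) * e t b c) = if s = t then 1 else 0)
    (S : (Fin n × Fin n) → (Fin n × Fin n) → (Fin n × Fin n) → ℂ)
    (hS : ∀ a : Fin n × Fin n, S a ∈ Submodule.span ℂ (Set.range e)) :
    ‖∑ a, ∑ b, ∑ c, S a b c * matMulTensor ℂ n n n a b c‖ ^ 2
      ≤ (∑ a, ∑ b, ∑ c, ‖S a b c‖ ^ 2) *
        ∑ s, ∑ a : Fin n × Fin n, ‖∑ m : Fin n, e s (a.1, m) (m, a.2)‖ ^ 2 := by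
  classical
  -- coefficients of the slices in the frame
  have hd : ∀ a : Fin n × Fin n, ∃ d : Fin k → ℂ, ∑ s, d s • e s = S a := fun a =>
    (Submodule.mem_span_range_iff_exists_fun ℂ).mp (hS a)
  choose d hd using hd
  have hexp : ∀ a b c, S a b c = ∑ s, d a s * e s b c := by
    intro a b c
    have h := congrFun (congrFun (hd a) b) c
    simpa [Finset.sum_apply, Pi.smul_apply, smul_eq_mul] using h.symm
  -- the pairing, slice by slice
  have hL : ∑ a, ∑ b, ∑ c, S a b c * matMulTensor ℂ n n n a b c
      = ∑ a, ∑ s, d a s * ∑ m : Fin n, e s (a.1, m) (m, a.2) := by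
    refine Finset.sum_congr rfl fun a _ => ?_
    rw [slice_sum_matMulTensor (S a) a]
    calc ∑ m : Fin n, S a (a.1, m) (m, a.2) = ∑ m : Fin n, ∑ s, d a s * e s (a.1, m) (m, a.2) :=
          Finset.sum_congr rfl fun m _ => hexp a _ _
      _ = ∑ s, ∑ m : Fin n, d a s * e s (a.1, m) (m, a.2) := Finset.sum_comm
      _ = ∑ s, d a s * ∑ m : Fin n, e s (a.1, m) (m, a.2) :=
          Finset.sum_congr rfl fun s _ => by rw [Finset.mul_sum]
  -- Parseval, slice by slice
  have hR : ∑ a, ∑ b, ∑ c, ‖S a b c‖ ^ 2 = ∑ a, ∑ s, ‖d a s‖ ^ 2 :=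
    Finset.sum_congr rfl fun a _ => parseval_slice e he (d a) (S a) (hexp a)
  rw [hL, hR, Finset.sum_comm (f := fun s (a : Fin n × Fin n) => ‖∑ m : Fin n, e s (a.1, m) (m, a.2)‖ ^ 2)]
  exact norm_sum_sum_mul_sq_le d fun a s => ∑ m : Fin n, e s (a.1, m) (m, a.2)


/-! ## The stubs (signatures over tree/Mathlib vocabulary only) -/

/-- **Stub 1 — product frames (provable now, size M).** The span of any `r` products `u_l ⊗ v_l` carries an
orthonormal basis `e` of `d ≤ r` vectors (orthonormal, inside the product span, with every product in `span e`).
Why true: Gram–Schmidt on `Submodule.span ℂ (range t)` inside `EuclideanSpace ℂ (P n × P n)` transported by currying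
(`stdOrthonormalBasis`, `d = finrank ≤ r` by `finrank_span_le_card`); both span inclusions hold by construction. This is where "`n²` products"
(the crux's rank bound, `Disproof.false_without_rank`) is turned into the hypothesis of stub 2. Leans on: Mathlib
`Submodule.span`, `stdOrthonormalBasis` / `gramSchmidtOrthonormalBasis`, `EuclideanSpace`, `finrank_span_le_card`. -/
theorem stub_productFrame {n r : ℕ} (u v : Fin r → (Fin n × Fin n) → ℂ) :
    ∃ (d : ℕ) (e : Fin d → (Fin n × Fin n) → (Fin n × Fin n) → ℂ), d ≤ r ∧
      (∀ s t : Fin d, (∑ b, ∑ c, conj (e s b c) * e t b c) = if s = t then 1 else 0) ∧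
      (∀ s, e s ∈ Submodule.span ℂ (Set.range fun l : Fin r => fun b c => u l b * v l c)) ∧
      ∀ l : Fin r, (fun b c => u l b * v l c) ∈ Submodule.span ℂ (Set.range e) :=
  -- LANDED (wave 1, p85652): `Theorems/FidelityWitnessesDiagonalPowerDecayStubProductFrame.lean`
  Summit.MatrixMultiplication.MatrixMultiplication.Theorems.DiagonalPowerDecay.stub_productFrame u v

/-- **Stub 2 — MIDDLE-PAIR NEGATIVITY DECAY (the load-bearing stub; OPEN, size XL).** Some `C`, `δ > 0`: for every
`n`, every `n²` products `u_l ⊗ v_l ∈ ℂ^{P n} ⊗ ℂ^{P n}` and every orthonormal basis `e` (`d ≤ n²` vectors) of their span, the partially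
transposed middle-pair reduction `R_E^Γ = redPT e` splits as `Y − Z`, `Y, Z ⪰ 0`, with `tr Y + tr Z ≤ C·n^{3−2δ}` —
i.e. `‖(Tr_{κν} P_E)^{Γ_{μ'}}‖₁ ≤ C n^{3−2δ}` against the ceiling `n · tr R_E = n³` attained by the slice space `W_n`
of `⟨n,n,n⟩` itself (`R_W = n|Ω̃⟩⟨Ω̃|/…`, not product-spanned).
Why plausibly true: it is implied by the card's T-free `NegativityDecay` (`‖P_E^Γ‖₁ ≤ C N^{3/2−δ}`, alive through
`N = 25` with falling ratio to the ceiling, j012660) via the trace-norm contraction `Tr_{κν}`, and it is far less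
exposed: generic frames have `R_E^Γ ≈ 1 ≻ 0` hence `‖R_E^Γ‖₁ = n²` EXACTLY (PPT; j014152, `n = 2, 3`, all random
restarts), the `ν_β`-maximisers (`‖P^Γ‖₁ = 6` at `N = 4`) are PPT in the middle pair too, and two-phase ascents
(j014267) put `sup ‖R_E^Γ‖₁` at `≈ 2+2√2 = 4.83` (`n = 2`, vs `M(2,4) = 4.41`, `ν_β = 6`) and `≈ 12.0` (`n = 3`, vs
`M(3,9) ≥ 10.99`, `ν_β ≥ 16.6`), i.e. this level tracks the crux quantity within `≈ 9 %` at `n ≤ 3` while being a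
convex (SDP) functional of `P_E` with `U(n)⁴` local covariance and exact multiplicativity under `⊗`. Why it might
fail: it is still STRONGER than the crux (dual witnesses
`U(n²)` instead of the orbit `SWAP·(X⊗X*)`), hence than `ω > 2` (`Disproof.omega_ge_of_body`); an `n²`-product family
whose middle pair is power-close to maximally entangled in negativity but decorrelated from `Ω̃` in every local basis
would kill it and leave the crux open. Size XL; no tool gives power gaps today (route § Kill (iii)). First rungs (line
card): the PPT law; the incoherent regime by the `ℓ₁(G⁻¹)` certificate; exact `ν_α(2)`. -/
theorem stub_middlePairNegativityDecay :
    ∃ C δ : ℝ, 0 < δ ∧ ∀ (n d : ℕ) (u v : Fin (n ^ 2) → (Fin n × Fin n) → ℂ)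
      (e : Fin d → (Fin n × Fin n) → (Fin n × Fin n) → ℂ), d ≤ n ^ 2 →
      (∀ s t : Fin d, (∑ b, ∑ c, conj (e s b c) * e t b c) = if s = t then 1 else 0) →
      (∀ s, e s ∈ Submodule.span ℂ (Set.range fun l : Fin (n ^ 2) => fun b c => u l b * v l c)) →
      (∀ l : Fin (n ^ 2), (fun b c => u l b * v l c) ∈ Submodule.span ℂ (Set.range e)) →
      ∃ Y Z : Matrix (Fin n × Fin n) (Fin n × Fin n) ℂ, Y.PosSemidef ∧ Z.PosSemidef ∧
        (Matrix.of fun x y : Fin n × Fin n =>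
          ∑ s, ∑ κ : Fin n, ∑ ν : Fin n, e s (κ, x.1) (y.2, ν) * conj (e s (κ, y.1) (x.2, ν))) = Y - Z ∧
        (Y.trace + Z.trace).re ≤ C * (n : ℝ) ^ (3 - 2 * δ) := by
  sorry

/-! ## The composition (kernel-checked, no `sorry` of its own) -/

/-- The output slices of a sum of triads lie in the span of any frame containing the products. -/
theorem slice_mem_span {n r d : ℕ} (e : Fin d → P n → P n → ℂ) (w u v : Fin r → P n → ℂ)
    (hprod : ∀ l : Fin r, prodVec (u l) (v l) ∈ Submodule.span ℂ (Set.range e)) (a : P n) :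
    (∑ i, triad (w i) (u i) (v i)) a ∈ Submodule.span ℂ (Set.range e) := by
  have hslice : (∑ i, triad (w i) (u i) (v i)) a = ∑ i, w i a • prodVec (u i) (v i) := by
    funext b c
    simp [Finset.sum_apply, triad_apply, prodVec, Pi.smul_apply, smul_eq_mul, mul_assoc]
  rw [hslice]
  exact Submodule.sum_mem _ fun i _ => Submodule.smul_mem _ _ (hprod i)

/-- **`DiagonalPowerDecay` from the two stubs.** A rank-`≤ n²` tensor `S` is a sum of `n²` triads
(`exists_eq_sum_triad_of_tensorRank_le`); the `n²` products `u_l ⊗ v_l` span a plane with orthonormal basis `e`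
(stub 1); its middle-pair reduction has a PSD splitting of trace `≤ C n^{3−2δ}` (stub 2), so `cap e ≤ C n^{3−2δ}`
(`cap_le_of_splitting`, kernel-checked); the output slices of `S` lie in `span e` (`slice_mem_span`), and slice elimination (`sliceElimination`, kernel-checked) gives
`|⟨S,T⟩|² ≤ ‖S‖² · cap e ≤ C n^{3−2δ} ‖S‖²`. The constants `(C, δ)` of the crux are those of stub 2. -/
theorem DiagonalPowerDecay_of : DiagonalPowerDecay := by
  obtain ⟨C, δ, hδ, hneg⟩ := stub_middlePairNegativityDecay
  refine ⟨C, δ, hδ, fun n S hS => ?_⟩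
  obtain ⟨w, u, v, hdec⟩ := exists_eq_sum_triad_of_tensorRank_le hS
  obtain ⟨d, e, hd, he, hps, hprod⟩ := stub_productFrame u v
  obtain ⟨Y, Z, hY, hZ, hsplit, htr⟩ := hneg n d u v e hd he hps hprod
  -- singlet fraction ≤ negativity (kernel-checked: `sum_redPT_flip` + `flipTraceBound`)
  have hcap : cap e ≤ (Y.trace + Z.trace).re := cap_le_of_splitting e hY hZ hsplit
  have hslices : ∀ a : P n, S a ∈ Submodule.span ℂ (Set.range e) := by
    intro a
    rw [hdec]
    exact slice_mem_span e w u v hprod a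
  have h1 := sliceElimination e he S hslices
  have hnn : (0 : ℝ) ≤ ∑ a, ∑ b, ∑ c, ‖S a b c‖ ^ 2 := by positivity
  calc ‖∑ a, ∑ b, ∑ c, S a b c * matMulTensor ℂ n n n a b c‖ ^ 2
      ≤ (∑ a, ∑ b, ∑ c, ‖S a b c‖ ^ 2) * cap e := h1
    _ ≤ (∑ a, ∑ b, ∑ c, ‖S a b c‖ ^ 2) * (C * (n : ℝ) ^ (3 - 2 * δ)) :=
        mul_le_mul_of_nonneg_left (hcap.trans htr) hnn
    _ = C * (n : ℝ) ^ (3 - 2 * δ) * ∑ a, ∑ b, ∑ c, ‖S a b c‖ ^ 2 := by ring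

end Summit.MatrixMultiplication.MatrixMultiplication.Cruxes.DiagonalPowerDecay.FrameNegativitySingletFraction

end
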